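import Summits.CriticalPhenomena.CardyFormulaZ2.Theses.CardyComplexCone
import Literature.Probability.LatticeModels.DobrushinDiscretisation
import Literature.Probability.Percolation.ZdNearCriticalWindow

/-!
# Line `overshoot-lune-sandwich` for crux `CardyComplexCone.SLESixFamiliesGiveCardy`
(stmt-CriticalPhenomena-9654; shared by CardySusyWard, CardySublatticeCoherence)

Skeleton (crux-plan, planner-cruxplan-stmt-CriticalPhenomena-9654-overshoot-lune-sandw-0,
2026-08-16) of crux idea `Cruxes/SLESixFamiliesGiveCardy/Ideas/overshoot-lune-sandwich.md`
(crux-ideate r1 ideator 1; triage r1-1/2/3: pass), with the triage sharpenings built in: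
no corner arm events (the comparison domains satisfy the far-in/far-out clauses at EVERY site,
so the `ρ`-free form of Bollobás–Riordan's lower inclusion is used, exactly as the tree's proved
`𝕋` theorem `mem_triCrossing_of_pathIn`); Radó is the PROVED tree theorem
`JordanDomain.rado_tendstoUniformlyOn_holds`; the Dobrushin junctions of the comparison domains
are FLAT and AXIS-PARALLEL (`IsFlatAt`), so admissible families are the half-mesh split of a
straight lattice row (triage F2) and item 9644 is not needed; both orientations of the crux's
endpoint rule are hidden inside the two escort-chain stubs (cf. Disproof `exactDictionary_holds`).

THE LINE.  The crux is literally `SLE6Families → CardyFormulaZ2` (`crux_iff`, `Iff.rfl`).  Fix a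
conformal rectangle `R = (Ω; a, b, c, d)`, a uniformizing datum `(φ, x)`, `η = crossRatio x`,
`θ > 0`.
* LOWER BOUND `F(η) - θ ≤ P[C_δ(R)]` eventually:  `stub_luneDomains.1` gives a comparison
  conformal rectangle `G = G⁻` ("longer and thinner": `G ∩ Ω` keeps distance `d` from
  `(bc) ∪ (da)`, `G ∖ Ω` is `t`-close to `(ab) ∪ (cd)`, the arcs `G.arc 0`, `G.arc 2` stick OUT
  of `Ω` — an `s`-neighbourhood of each lies off `Ω`, `t`-close to `(ab)`, `(cd)` — flat
  axis-parallel boundary at `G.pt 0`, `G.pt 2`, and `|F(η_G) - F(η)| ≤ θ`);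
  `stub_flatJunctionFamily` gives an admissible discretisation family `Λ` of `(G; a_G, c_G)`;
  the antecedent `H = SLE6Families` gives SLE₆ convergence of the oriented interface of `Λ δ`;
  `stub_proximityBounds` (portmanteau on the OPEN events `mk '' hitsBeforeApprox`, the `G_δσ`
  exhaustion `hitsBefore_eq_iUnion_iInter`, LSW's hitting law `sle_six_measureReal_hitsBefore`,
  discharged in tree) gives `F(η_G) - θ ≤ P[interface within a of G.arc 2 before the b-collar of
  G.arc 1]` eventually; `stub_openEscortChain` turns that proximity event into an `ω`-OPEN lattice
  chain from `ε`-near `G.arc 0` to `(a+ε)`-near `G.arc 2` staying `b - ε` off `G.arc 1`; by the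
  geometry of `G` this chain starts and ends OUTSIDE `Ω` near `(ab)`, `(cd)` and satisfies the
  far-in/far-out clauses, so `stub_overshootInclusion` (ℤ² port of B–R Claim 19, lower half)
  puts `ω` in `discreteCrossing Ω δ (ab) (cd)`; monotonicity of `P`.
* UPPER BOUND `P[C_δ(R)] ≤ F(η) + θ` eventually: the mirror image with `G = G⁺` ("shorter and
  fatter", `stub_luneDomains.2`, `d` chosen BEFORE `t` so that `ρ := d` can be fed to
  `stub_dualOvershootExclusion`), the complementary proximity event (`stub_proximityBounds`, second
  conjunct, `1 - F`), the DUAL escort chain (`stub_dualEscortChain`: closed primal edges crossed, from near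
  `G.arc 3` to near `G.arc 1`, off `G.arc 2`), and the ℤ²-dual port of B–R Claim 19 upper half
  (`stub_dualOvershootExclusion`: such a chain excludes `discreteCrossing`); `P(U) + P(C) ≤ 1`
  for the disjoint events (`measurableSet_discreteCrossing`).
* `cardy_of_statements` (the seven statements as hypotheses) / `SLESixFamiliesGiveCardy_of` (the
  seven `stub_*` plugged in; concludes the route decl BY NAME): the two eventual bounds
  (`eventually_le_crossingProb`, `crossingProb_eventually_le`) give `Tendsto`
  (`tendsto_of_eventually_le_le`).

Disproof.lean (cdisprove gen 2, cycle 2) has NO `_false_without_<H>` theorem; honoured: gen-1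
`not_naiveHittingTransfer` / `hitsBefore_not_isOpen/_not_isClosed` / `not_interfaceHittingTransfer`
(no hitting probability of a lattice curve is transferred: only OPEN `hitsBeforeApprox` events and
one-sided eventual bounds, stubs 5–7), §2b/§3 `orientation_loadBearing` + `exactDictionary_holds`
(the oriented `interfaceMap` is consumed verbatim; both windows inside stubs 6–7), §3 DUALITY-STEP
JUNK (no `p + q ≤ 1 + ε` for two free crossings: the upper bound uses an event INCLUDED in the
complement of the same crossing event), `summit_clusterPt_mem_Ioo` (limits `F(η) ∈ (0,1)`),
`familyHyps_discData` (families exist; here `stub_flatJunctionFamily`).  No landed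
`Theorems/SLESixFamiliesGiveCardy/Negative/*` lemma exists.  Negatives index: only stmt-0748
(NegDegenerateArcs) concerns this conjunct; every limit here is `F(η)`, `η ∈ (0,1)`.
-/

noncomputable section

open MeasureTheory Filter Set Metric Topology
open scoped unitInterval NNReal
open Literature.Probability.Percolation Literature.Probability.LatticeModels
open Literature.Probability.RandomPlanarGeometry
open UpperHalfPlane (upperHalfPlaneSet)
open Summit.CriticalPhenomena.CardyFormulaZ2.Theses.CardyComplexCone

namespace Summit.CriticalPhenomena.CardyFormulaZ2.Cruxes.SLESixFamiliesGiveCardy.OvershootLuneSandwich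

set_option linter.unusedVariables false

/-! ## Vocabulary (verbatim abbreviations of the crux's own clauses) -/

/-- The interface map of the crux at data `E` (verbatim the inline lambda of the route file and of
Disproof.lean's `interfaceMap`): the class of the endpoint-oriented medial exploration curve. -/
def interfaceMap (D : DobrushinDomain) (E : DiscreteDobrushin) (ω : BondConfig (Site 2)) :
    CurveClass ℂ :=
  CurveClass.mk (if dist (medialExplorationCurve E ω 0) (D.pt 0) ≤
      dist (medialExplorationCurve E ω 0) (D.pt 1) then
    (⟨medialExplorationCurve E ω⟩ : Curve ℂ)
    else ⟨(medialExplorationCurve E ω).comp ⟨unitInterval.symm, unitInterval.continuous_symm⟩⟩)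

/-- The antecedent of the crux (SLE₆ for every Dobrushin domain and every discretisation family,
six unbundled `ZdDiscretisationFamily` fields), verbatim. -/
def SLE6Families : Prop :=
  ∀ (D : DobrushinDomain) (Λ : ℝ → DiscreteDobrushin), (∀ δ, (Λ δ).Ω = D.carrier) →
    (∀ δ, (Λ δ).δ = δ) →
    Tendsto (fun δ : ℝ => Metric.hausdorffEDist (Λ δ).arcA (D.arc 0)) (𝓝[>] (0:ℝ)) (𝓝 0) →
    Tendsto (fun δ : ℝ => Metric.hausdorffEDist (Λ δ).arcB (D.arc 1)) (𝓝[>] (0:ℝ)) (𝓝 0) →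
    Tendsto (fun δ : ℝ => Metric.hausdorffEDist (medialPoint δ '' (Λ δ).zdABEdges) {D.pt 0, D.pt 1})
      (𝓝[>] (0:ℝ)) (𝓝 0) →
    (∀ᶠ δ in 𝓝[>] (0:ℝ), (Λ δ).IsZdAdmissible) →
    ConvergesInLawToSLE 6 D (Ωδ := fun _ => BondConfig (Site 2)) (fun δ ω => interfaceMap D (Λ δ) ω)
      (fun _ => bondPercolation (zdGraph 2) half)

/-- The crux is literally `SLE6Families → CardyFormulaZ2`. -/
theorem crux_iff : SLESixFamiliesGiveCardy ↔ (SLE6Families → _root_.CardyFormulaZ2) := Iff.rfl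

/-- **Flat axis-parallel junction** at the marked point `G.pt j`: in some disc around `G.pt j` the
domain is the open half-disc on the side of an axis direction `u ∈ {1, -1, i, -i}` (so `∂G` is a
straight lattice-parallel segment through `G.pt j` there).  This is the "designer junction" of the
card: discrete Dobrushin data with the `A`/`B` split at a lattice mid-edge of the first row are
admissible (triage F2), whatever the rest of `∂G`. -/
def IsFlatAt (G : ConformalRectangle) (j : Fin 4) : Prop :=
  ∃ r > (0:ℝ), ∃ u : ℂ, (u = 1 ∨ u = -1 ∨ u = Complex.I ∨ u = -Complex.I) ∧
    G.carrier ∩ Metric.ball (G.pt j) r =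
      {z | z ∈ Metric.ball (G.pt j) r ∧ 0 < ((z - G.pt j) * (starRingEnd ℂ) u).re}

/-! ## The statements of the line (one `def … : Prop` per stub, so that the two half-assemblies
and the composition can name them; each `stub_*` theorem below has exactly one of these as type) -/

/-- **OvershootInclusion** (Bollobás–Riordan 2006, Ch. 7, Claim 19 lower half + Claim 20,
`ρ`-FREE form; the ℤ²-bond port of the PROVED `𝕋` theorem `mem_triCrossing_of_pathIn` of
`TriCrossingSandwich.lean`).  An `ω`-open chain of `δℤ²` which starts off `Ω` within `t` of
`(ab)`, ends off `Ω` within `t` of `(cd)`, whose sites off `Ω` are `t`-close to `(ab) ∪ (cd)` and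
whose sites in `Ω` are farther than `δ` from `(bc) ∪ (da)`, contains a G02 crossing
`discreteCrossing Ω δ (ab) (cd)` (largest component, closed-segment mesh edges, `≤`-rule arcs).
ℤ²-only point (card + triage): an inside–inside step whose segment leaves `Ω̄` meets `∂Ω` within
`δ` of both ends, hence on `(ab) ∪ (cd)` — a jump GATE through `discreteArc`, not a hole; the
macroscopic run lies in the giant component by `JordanDomain.mul_sub_lt_of_stray` /
`exists_forall_mem_meshDomain_and_reachable`.  `N = 0` and all-exterior chains are excluded by
`t₀ < dist((ab),(cd))/2`.  Size M–L (≈ the 1.4 kLoC `𝕋` file, ported). -/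
def OvershootInclusion : Prop :=
  ∀ R : ConformalRectangle,
    ∃ δ₀ > (0:ℝ), ∃ t₀ > (0:ℝ), ∀ δ t : ℝ, 0 < δ → δ < δ₀ → 0 ≤ t → t ≤ t₀ →
      ∀ (ω : BondConfig (Site 2)) (N : ℕ) (v : ℕ → Site 2),
        (∀ i < N, (zdGraph 2).Adj (v i) (v (i + 1)) ∧ s(v i, v (i + 1)) ∈ ω) →
        (∀ i ≤ N, meshPoint δ (v i) ∉ R.carrier →
          infDist (meshPoint δ (v i)) (R.arc 0) ≤ t ∨ infDist (meshPoint δ (v i)) (R.arc 2) ≤ t) →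
        (∀ i ≤ N, meshPoint δ (v i) ∈ R.carrier →
          δ < infDist (meshPoint δ (v i)) (R.arc 1) ∧ δ < infDist (meshPoint δ (v i)) (R.arc 3)) →
        meshPoint δ (v 0) ∉ R.carrier → infDist (meshPoint δ (v 0)) (R.arc 0) ≤ t →
        meshPoint δ (v N) ∉ R.carrier → infDist (meshPoint δ (v N)) (R.arc 2) ≤ t →
        ω ∈ discreteCrossing R.carrier δ (R.arc 0) (R.arc 2)

/-- **DualOvershootExclusion** (Bollobás–Riordan 2006, Ch. 7, Claim 19 upper half, for the SQUARE
lattice via planar duality instead of Lemma 5; the ℤ²-dual port of the PROVED `𝕋` theorem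
`not_mem_triCrossing_compl_of_pathIn`).  A chain of dual sites (faces of `δℤ²`, indexed by their
lower-left corners as everywhere in the tree — `dualConfig`, `annulusDualCrossing`,
`exists_right_chain` — positions measured at `meshPoint δ (f i)`) whose consecutive faces are
joined by dual edges of `dualConfig ω` (the primal edge crossed is CLOSED), starting in a face
`4δ`-off `Ω̄` near `(da)` and ending in a face `4δ`-off `Ω̄` near `(bc)`, with corners off `Ω`
`t`-close to `(bc) ∪ (da)` and corners in `Ω` farther than `4δ` from `(ab) ∪ (cd)` and `ρ`-far
from the marked points, contains (between its last `(da)`-type exterior face and its first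
`(bc)`-type one, `t₀ + δ₀ < dist((bc),(da))/2`) a closed dual cross-cut of `Ω̄` from `(da)°` to
`(bc)°` staying `> 2δ` off `(ab) ∪ (cd)`; no open path of `Ω_δ` crosses it (an open primal edge and
a `dualConfig`-edge never cross) and it separates `(ab)_δ` from `(cd)_δ`, so
`ω ∉ discreteCrossing Ω δ (ab) (cd)`.  Topology as in the `𝕋` file
(`not_mem_triCrossing_compl_of_latticeCrosscut`, `Newman1939_crosscut_holds`, `JordanCurveTheorem`).
Size M–L. -/
def DualOvershootExclusion : Prop :=
  ∀ (R : ConformalRectangle) (ρ : ℝ), 0 < ρ →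
    ∃ δ₀ > (0:ℝ), ∃ t₀ > (0:ℝ), ∀ δ t : ℝ, 0 < δ → δ < δ₀ → 0 ≤ t → t ≤ t₀ →
      ∀ (ω : BondConfig (Site 2)) (N : ℕ) (f : ℕ → Site 2),
        (∀ i < N, (zdGraph 2).Adj (f i) (f (i + 1)) ∧ s(f i, f (i + 1)) ∈ dualConfig ω) →
        (∀ i ≤ N, meshPoint δ (f i) ∉ R.carrier →
          infDist (meshPoint δ (f i)) (R.arc 1) ≤ t ∨ infDist (meshPoint δ (f i)) (R.arc 3) ≤ t) →
        (∀ i ≤ N, meshPoint δ (f i) ∈ R.carrier →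
          4 * δ < infDist (meshPoint δ (f i)) (R.arc 0) ∧
            4 * δ < infDist (meshPoint δ (f i)) (R.arc 2) ∧
            ∀ j : Fin 4, ρ ≤ dist (meshPoint δ (f i)) (R.pt j)) →
        4 * δ ≤ infDist (meshPoint δ (f 0)) R.carrier →
        infDist (meshPoint δ (f 0)) (R.arc 3) ≤ t →
        4 * δ ≤ infDist (meshPoint δ (f N)) R.carrier →
        infDist (meshPoint δ (f N)) (R.arc 1) ≤ t →
        ω ∉ discreteCrossing R.carrier δ (R.arc 0) (R.arc 2)

/-- **LowerLuneDomain** (THE LEVER's geometry, lower half: conformal collars inside ⊕ lunes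
outside, flat caps at the two Dobrushin junctions, modulus continuity by Radó).  For a conformal
rectangle `R = (Ω; a,b,c,d)` with uniformizing datum `(φ, x)` and `θ > 0` there is `d > 0` such
that for every `t > 0` there is a comparison conformal rectangle `G = G⁻` ("longer, thinner":
built from `f((ε₁, L-ε₁) × (0,1))`, `f` the rectangle map of `R`, `ε₁ = ε₁(θ)`, plus exterior lunes
`g({1 < |w| < 1+τ, arg w ∈ I})` over the corresponding open sub-arcs of `(ab)`, `(cd)`, `g` the
exterior Riemann map, marked at the outer lune corners, flattened axis-parallel near `G.pt 0`,
`G.pt 2`) with a uniformizing datum `(ψ, y)`, `|F(crossRatio y) - F(crossRatio x)| ≤ θ`, such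
that `G ∩ Ω` keeps distance `d = d(ε₁)` from `(bc) ∪ (da)`, `G ∖ Ω` is `t`-close to
`(ab) ∪ (cd)`, and the closed `s`-neighbourhoods of `G.arc 0`, `G.arc 2` lie off `Ω`, `t`-close to
`(ab)`, resp. `(cd)`.  Why true: as `τ`, caps `→ 0` (with `ε₁` fixed) the boundary loops converge
uniformly to that of `f(sub-rectangle)`, whose modulus is explicit and `→ η(R)` as `ε₁ → 0`; Radó
(`rado_tendstoUniformlyOn_holds`, closed-disc form) + Carathéodory injectivity move the mark
preimages continuously, hence `crossRatio` (`exists_isUniformizing_holds`,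
`crossRatio_eq_of_isUniformizing_holds`) and `F` (continuous); Jordan-domain structure of `G` via
`JordanDomain.ofLoop`.  Size L (HARDEST: new constructions, no tree template). -/
def LowerLuneDomain : Prop :=
  ∀ (R : ConformalRectangle) (φ : ConformalEquiv upperHalfPlaneSet R.carrier) (x : Fin 4 → ℝ),
    R.IsUniformizing φ x → ∀ θ > (0:ℝ), ∃ d > (0:ℝ), ∀ t > (0:ℝ),
      ∃ (G : ConformalRectangle) (ψ : ConformalEquiv upperHalfPlaneSet G.carrier) (y : Fin 4 → ℝ),
        G.IsUniformizing ψ y ∧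
        |cardyFunction (crossRatio y) - cardyFunction (crossRatio x)| ≤ θ ∧
        IsFlatAt G 0 ∧ IsFlatAt G 2 ∧
        (∀ z ∈ G.carrier, z ∉ R.carrier →
          infDist z (R.arc 0) ≤ t ∨ infDist z (R.arc 2) ≤ t) ∧
        (∀ z ∈ G.carrier, z ∈ R.carrier → d ≤ infDist z (R.arc 1) ∧ d ≤ infDist z (R.arc 3)) ∧
        ∃ s > (0:ℝ),
          (∀ z, infDist z (G.arc 0) ≤ s → z ∉ R.carrier ∧ infDist z (R.arc 0) ≤ t) ∧
          (∀ z, infDist z (G.arc 2) ≤ s → z ∉ R.carrier ∧ infDist z (R.arc 2) ≤ t)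

/-- **UpperLuneDomain** (upper half: the same with the roles of the two pairs of arcs exchanged —
`G = G⁺`, "shorter, fatter": `f((0,L) × (ε₁, 1-ε₁))` plus lunes over sub-arcs of `(bc)`, `(da)`,
marked at the outer lune corners so that `G.arc 1`, `G.arc 3` are the outer lune arcs).  Here the
`s`-neighbourhoods of `G.arc 3`, `G.arc 1` are `s`-FAR from `Ω` (the dual chain must start and
end in faces off `Ω̄`) and `G ∩ Ω` is `d`-far from `(ab) ∪ (cd)` and from the four marked points
(`d` is chosen BEFORE `t`, so that `ρ := d` can be fed to `DualOvershootExclusion`, whose `t₀`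
depends on `ρ`).  Same proof as `LowerLuneDomain`.  Size L (with the lower half). -/
def UpperLuneDomain : Prop :=
  ∀ (R : ConformalRectangle) (φ : ConformalEquiv upperHalfPlaneSet R.carrier) (x : Fin 4 → ℝ),
    R.IsUniformizing φ x → ∀ θ > (0:ℝ), ∃ d > (0:ℝ), ∀ t > (0:ℝ),
      ∃ (G : ConformalRectangle) (ψ : ConformalEquiv upperHalfPlaneSet G.carrier) (y : Fin 4 → ℝ),
        G.IsUniformizing ψ y ∧
        |cardyFunction (crossRatio y) - cardyFunction (crossRatio x)| ≤ θ ∧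
        IsFlatAt G 0 ∧ IsFlatAt G 2 ∧
        (∀ z ∈ G.carrier, z ∉ R.carrier →
          infDist z (R.arc 1) ≤ t ∨ infDist z (R.arc 3) ≤ t) ∧
        (∀ z ∈ G.carrier, z ∈ R.carrier →
          d ≤ infDist z (R.arc 0) ∧ d ≤ infDist z (R.arc 2) ∧ ∀ j : Fin 4, d ≤ dist z (R.pt j)) ∧
        ∃ s > (0:ℝ),
          (∀ z, infDist z (G.arc 3) ≤ s → s ≤ infDist z R.carrier ∧ infDist z (R.arc 3) ≤ t) ∧
          (∀ z, infDist z (G.arc 1) ≤ s → s ≤ infDist z R.carrier ∧ infDist z (R.arc 1) ≤ t)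

/-- **FlatJunctionFamily** (NiceJunctionFamily of the card, in the flat axis-parallel form of
triage F2 / r1-2).  A conformal rectangle whose boundary is a straight lattice-parallel segment
near `a = G.pt 0` and near `c = G.pt 2` admits a discretisation family of the Dobrushin domain
`(G; a, c) = G.chord 0 2`: `Ω = G`, mesh `δ`, arcs `(abc)` / `(cda)` split per `δ` at the lattice
MID-EDGE of the first row nearest to `a` (resp. `c`), so that no boundary site is equidistant from
the two arcs there (ties elsewhere are impossible for small `δ`: `zdBoundary` sites lie within
`√2 δ` of `∂G`, and `(abc) ∖ (B(a,r) ∪ B(c,r))`, `(cda) ∖ (B(a,r) ∪ B(c,r))` are disjoint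
compacta), exactly two `A`–`B` edges (in the two first rows), each a side of exactly one inner face
(the first rows join the bulk, `exists_forall_mem_meshDomain_and_reachable`); Hausdorff guards at
rate `O(δ)`.  Replaces the dependence on item 9644 (`DiscretisationFamilyExists`) at ROUGH marks.
Size M. -/
def FlatJunctionFamily : Prop :=
  ∀ G : ConformalRectangle, IsFlatAt G 0 → IsFlatAt G 2 →
    ∃ Λ : ℝ → DiscreteDobrushin, ZdDiscretisationFamily (G.chord 0 2 (by decide)) Λ

/-- **ProximityBounds** (the SLE side of the one-sided dictionary; no lattice geometry) — stated
VERBATIM as the sibling line's `ConformalCollarSsBridge.stub_proximityLiminf` (shared stub: prove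
once, the term proves both).  Whatever the interfaces `X δ` are, convergence in law to chordal
SLE₆ in `(G; a, c)` gives for the OPEN proximity events
`U₂(a,b) = mk '' hitsBeforeApprox (cd) (bc) a b` and `U₁(a,b) = mk '' hitsBeforeApprox (bc) (cd) a b`
the eventual bounds `P[X δ ∈ U₂(a,b)] ≥ F(η_G) - θ` and `P[X δ ∈ U₁(a,b)] ≥ 1 - F(η_G) - θ` for
some `b = b(θ) > 0` and every `a > 0`: portmanteau for open sets
(`convergesInLawToSLE_iff_tendstoInDistribution`; `isOpen_hitsBeforeApprox`, saturation
`mem_of_isOpen_of_dist_eq_zero`, open image under the quotient map), the `G_δσ` exhaustion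
`hitsBefore_eq_iUnion_iInter` (continuity from below in `n`, monotonicity in `a`, `b`), and the
SLE₆ hitting law `sle_six_measureReal_hitsBefore` (PROVED, `_holds`) for `U₂`; for `U₁` the law of
`hitsBefore (bc) (cd)` in `(G; a, c)` is `1 - F(η_G)` — the same fact on the orientation-reversed
rectangle `(Ω; a, d, c, b)` (same chord `(a, c)`; cross-ratio `1 - η`, Disproof
`crossRatio_swap13`; `cardyFunction_one_sub_holds`), or directly the first-hit distribution of
`(bcd)` (no atom at `c`; the curve hits `(bcd) ∖ {c}` a.s. before its end, `κ > 4`).  Honours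
Disproof gen-1: no hitting probability of a LATTICE curve is evaluated.  Size M. -/
def ProximityBounds : Prop :=
  ∀ (G : ConformalRectangle) (X : ℝ → BondConfig (Site 2) → CurveClass ℂ),
    ConvergesInLawToSLE 6 (G.chord 0 2 (by decide)) (Ωδ := fun _ => BondConfig (Site 2)) X
        (fun _ => bondPercolation (zdGraph 2) half) →
    ∀ (ψ : ConformalEquiv upperHalfPlaneSet G.carrier) (y : Fin 4 → ℝ), G.IsUniformizing ψ y →
      ∀ θ > (0:ℝ), ∃ b > (0:ℝ), ∀ a > (0:ℝ), ∀ᶠ δ in 𝓝[>] (0:ℝ),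
        cardyFunction (crossRatio y) - θ ≤
            (bondPercolation (zdGraph 2) half).real
              ((X δ) ⁻¹' (CurveClass.mk '' CurveClass.hitsBeforeApprox (G.arc 2) (G.arc 1) a b)) ∧
        1 - cardyFunction (crossRatio y) - θ ≤
            (bondPercolation (zdGraph 2) half).real
              ((X δ) ⁻¹' (CurveClass.mk '' CurveClass.hitsBeforeApprox (G.arc 1) (G.arc 2) a b))

/-- **OpenEscortChain** (the lattice side of the dictionary, `→` direction only, for the ORIENTED
interface exactly as the crux types it).  For a discretisation family `Λ` of `(G; a, c)` and
`ε, a, b > 0`, for all small `δ`: if the oriented exploration interface of `Λ δ` comes within `a`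
of `(cd) = G.arc 2` at a time up to which it stayed farther than `b` from `(bc) = G.arc 1`, then
there is an `ω`-OPEN chain of lattice sites of `Ω_δ(G)` from an `ε`-neighbourhood of `(ab)` to an
`(a + ε)`-neighbourhood of `(cd)`, all of whose sites are at distance `≥ b - ε` from `(bc)`.
Proof: the open event is saturated, so the oriented polyline itself lies in `hitsBeforeApprox`;
by `existsUnique_medialExploration_holds` (tree theorem; admissibility is eventual) the
exploration is genuine; the localised LEFT chain `IsMedialExploration.exists_left_chain_near`
(forward window; backward window with left/right swapped when the endpoint rule reverses the list
— Disproof §2b/§4, `exactDictionary_holds`) is `bcBondConfig`-open with every vertex within `δ`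
of the polyline at an earlier time; cut it at its LAST `zdArcA` vertex (after which
`bcBondConfig`-open = `ω`-open, `mem_bcBondConfig_iff`); that vertex lies within `√2 δ` of `∂G`,
hence of `arcA`, hence (being `b - δ` off `G.arc 1`) within `√2 δ +` guard of `G.arc 0`; `ε`
absorbs `3δ +` the Hausdorff guards eventually.  Size M. -/
def OpenEscortChain : Prop :=
  ∀ (G : ConformalRectangle) (Λ : ℝ → DiscreteDobrushin),
    ZdDiscretisationFamily (G.chord 0 2 (by decide)) Λ → ∀ ε a b : ℝ, 0 < ε → 0 < a → 0 < b →
    ∀ᶠ δ in 𝓝[>] (0:ℝ), ∀ ω : BondConfig (Site 2),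
      interfaceMap (G.chord 0 2 (by decide)) (Λ δ) ω ∈
          CurveClass.mk '' CurveClass.hitsBeforeApprox (G.arc 2) (G.arc 1) a b →
        ∃ (N : ℕ) (v : ℕ → Site 2),
          (∀ i < N, (zdGraph 2).Adj (v i) (v (i + 1)) ∧ s(v i, v (i + 1)) ∈ ω) ∧
          (∀ i ≤ N, v i ∈ meshDomain G.carrier δ) ∧
          infDist (meshPoint δ (v 0)) (G.arc 0) ≤ ε ∧
          infDist (meshPoint δ (v N)) (G.arc 2) ≤ a + ε ∧
          ∀ i ≤ N, b - ε ≤ infDist (meshPoint δ (v i)) (G.arc 1)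

/-- **DualEscortChain** (mirror of `OpenEscortChain` on the dual-wired side).  For all small `δ`:
if the oriented interface of `Λ δ` comes within `a` of `(bc) = G.arc 1` at a time up to which it
stayed farther than `b` from `(cd) = G.arc 2`, then there is a chain of faces of `Ω_δ(G)`
(lower-left corners in `meshDomain`), consecutive ones joined by dual edges of `dualConfig ω` (the
crossed primal edge is CLOSED in `ω`), from an `ε`-neighbourhood of `(da) = G.arc 3` to an
`(a + ε)`-neighbourhood of `(bc)`, all `≥ b - ε` off `(cd)`.  Proof: the localised RIGHT chain
`IsMedialExploration.exists_right_chain_near` (faces = the inner faces of the darts, within `3δ`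
of the polyline at earlier times) is open in `dualConfig (bcBondConfig ω)`; a step NOT certified
in `dualConfig ω` crosses an `ω`-open edge closed by the boundary condition, i.e. (the curve never
crosses a non-`Ω_δ` edge: both its faces are non-inner) an edge touching `zdArcB`, which before
the `b`-collar of `G.arc 2` is reached lies within `√2 δ +` guard of `G.arc 3`; cut at the LAST
such step (or start at the first dart's face, `3δ`-close to the oriented start, itself guard-close
to `a = G.pt 0 ∈ G.arc 3`).  Orientation windows as in `OpenEscortChain`.  Size M. -/
def DualEscortChain : Prop :=
  ∀ (G : ConformalRectangle) (Λ : ℝ → DiscreteDobrushin),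
    ZdDiscretisationFamily (G.chord 0 2 (by decide)) Λ → ∀ ε a b : ℝ, 0 < ε → 0 < a → 0 < b →
    ∀ᶠ δ in 𝓝[>] (0:ℝ), ∀ ω : BondConfig (Site 2),
      interfaceMap (G.chord 0 2 (by decide)) (Λ δ) ω ∈
          CurveClass.mk '' CurveClass.hitsBeforeApprox (G.arc 1) (G.arc 2) a b →
        ∃ (N : ℕ) (f : ℕ → Site 2),
          (∀ i < N, (zdGraph 2).Adj (f i) (f (i + 1)) ∧ s(f i, f (i + 1)) ∈ dualConfig ω) ∧
          (∀ i ≤ N, f i ∈ meshDomain G.carrier δ) ∧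
          infDist (meshPoint δ (f 0)) (G.arc 3) ≤ ε ∧
          infDist (meshPoint δ (f N)) (G.arc 1) ≤ a + ε ∧
          ∀ i ≤ N, b - ε ≤ infDist (meshPoint δ (f i)) (G.arc 2)

/-! ## The registered stubs (the only `sorry`s of the file; each restates its `def` above VERBATIM with the local
abbreviations `IsFlatAt`, `interfaceMap` unfolded, so that the registered signature is self-contained over tree
declarations and `stub_x : X` holds by unfolding) -/

/-- Stub 1 (M–L): ℤ² port of B–R Claim 19, lower half (`ρ`-free). See `OvershootInclusion`. -/
theorem stub_overshootInclusion :
    ∀ R : ConformalRectangle,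
      ∃ δ₀ > (0:ℝ), ∃ t₀ > (0:ℝ), ∀ δ t : ℝ, 0 < δ → δ < δ₀ → 0 ≤ t → t ≤ t₀ →
        ∀ (ω : BondConfig (Site 2)) (N : ℕ) (v : ℕ → Site 2),
          (∀ i < N, (zdGraph 2).Adj (v i) (v (i + 1)) ∧ s(v i, v (i + 1)) ∈ ω) →
          (∀ i ≤ N, meshPoint δ (v i) ∉ R.carrier →
            infDist (meshPoint δ (v i)) (R.arc 0) ≤ t ∨ infDist (meshPoint δ (v i)) (R.arc 2) ≤ t) →
          (∀ i ≤ N, meshPoint δ (v i) ∈ R.carrier →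
            δ < infDist (meshPoint δ (v i)) (R.arc 1) ∧ δ < infDist (meshPoint δ (v i)) (R.arc 3)) →
          meshPoint δ (v 0) ∉ R.carrier → infDist (meshPoint δ (v 0)) (R.arc 0) ≤ t →
          meshPoint δ (v N) ∉ R.carrier → infDist (meshPoint δ (v N)) (R.arc 2) ≤ t →
          ω ∈ discreteCrossing R.carrier δ (R.arc 0) (R.arc 2) := by
  sorry

/-- Stub 2 (M–L): ℤ²-dual port of B–R Claim 19, upper half. See `DualOvershootExclusion`. -/
theorem stub_dualOvershootExclusion :
    ∀ (R : ConformalRectangle) (ρ : ℝ), 0 < ρ →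
      ∃ δ₀ > (0:ℝ), ∃ t₀ > (0:ℝ), ∀ δ t : ℝ, 0 < δ → δ < δ₀ → 0 ≤ t → t ≤ t₀ →
        ∀ (ω : BondConfig (Site 2)) (N : ℕ) (f : ℕ → Site 2),
          (∀ i < N, (zdGraph 2).Adj (f i) (f (i + 1)) ∧ s(f i, f (i + 1)) ∈ dualConfig ω) →
          (∀ i ≤ N, meshPoint δ (f i) ∉ R.carrier →
            infDist (meshPoint δ (f i)) (R.arc 1) ≤ t ∨ infDist (meshPoint δ (f i)) (R.arc 3) ≤ t) →
          (∀ i ≤ N, meshPoint δ (f i) ∈ R.carrier →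
            4 * δ < infDist (meshPoint δ (f i)) (R.arc 0) ∧
              4 * δ < infDist (meshPoint δ (f i)) (R.arc 2) ∧
              ∀ j : Fin 4, ρ ≤ dist (meshPoint δ (f i)) (R.pt j)) →
          4 * δ ≤ infDist (meshPoint δ (f 0)) R.carrier →
          infDist (meshPoint δ (f 0)) (R.arc 3) ≤ t →
          4 * δ ≤ infDist (meshPoint δ (f N)) R.carrier →
          infDist (meshPoint δ (f N)) (R.arc 1) ≤ t →
          ω ∉ discreteCrossing R.carrier δ (R.arc 0) (R.arc 2) := by
  sorry

/-- Stub 3 (L, HARDEST): the two families of comparison conformal rectangles with flat junctions,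
overshooting arcs and controlled modulus (Radó). See `LowerLuneDomain`, `UpperLuneDomain`. -/
theorem stub_luneDomains :
    (∀ (R : ConformalRectangle) (φ : ConformalEquiv upperHalfPlaneSet R.carrier) (x : Fin 4 → ℝ),
      R.IsUniformizing φ x → ∀ θ > (0:ℝ), ∃ d > (0:ℝ), ∀ t > (0:ℝ),
        ∃ (G : ConformalRectangle) (ψ : ConformalEquiv upperHalfPlaneSet G.carrier) (y : Fin 4 → ℝ),
          G.IsUniformizing ψ y ∧
          |cardyFunction (crossRatio y) - cardyFunction (crossRatio x)| ≤ θ ∧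
          (∃ r > (0:ℝ), ∃ u : ℂ, (u = 1 ∨ u = -1 ∨ u = Complex.I ∨ u = -Complex.I) ∧
            G.carrier ∩ Metric.ball (G.pt 0) r =
              {z | z ∈ Metric.ball (G.pt 0) r ∧ 0 < ((z - G.pt 0) * (starRingEnd ℂ) u).re}) ∧
          (∃ r > (0:ℝ), ∃ u : ℂ, (u = 1 ∨ u = -1 ∨ u = Complex.I ∨ u = -Complex.I) ∧
            G.carrier ∩ Metric.ball (G.pt 2) r =
              {z | z ∈ Metric.ball (G.pt 2) r ∧ 0 < ((z - G.pt 2) * (starRingEnd ℂ) u).re}) ∧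
          (∀ z ∈ G.carrier, z ∉ R.carrier →
            infDist z (R.arc 0) ≤ t ∨ infDist z (R.arc 2) ≤ t) ∧
          (∀ z ∈ G.carrier, z ∈ R.carrier → d ≤ infDist z (R.arc 1) ∧ d ≤ infDist z (R.arc 3)) ∧
          ∃ s > (0:ℝ),
            (∀ z, infDist z (G.arc 0) ≤ s → z ∉ R.carrier ∧ infDist z (R.arc 0) ≤ t) ∧
            (∀ z, infDist z (G.arc 2) ≤ s → z ∉ R.carrier ∧ infDist z (R.arc 2) ≤ t)) ∧
    (∀ (R : ConformalRectangle) (φ : ConformalEquiv upperHalfPlaneSet R.carrier) (x : Fin 4 → ℝ),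
      R.IsUniformizing φ x → ∀ θ > (0:ℝ), ∃ d > (0:ℝ), ∀ t > (0:ℝ),
        ∃ (G : ConformalRectangle) (ψ : ConformalEquiv upperHalfPlaneSet G.carrier) (y : Fin 4 → ℝ),
          G.IsUniformizing ψ y ∧
          |cardyFunction (crossRatio y) - cardyFunction (crossRatio x)| ≤ θ ∧
          (∃ r > (0:ℝ), ∃ u : ℂ, (u = 1 ∨ u = -1 ∨ u = Complex.I ∨ u = -Complex.I) ∧
            G.carrier ∩ Metric.ball (G.pt 0) r =
              {z | z ∈ Metric.ball (G.pt 0) r ∧ 0 < ((z - G.pt 0) * (starRingEnd ℂ) u).re}) ∧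
          (∃ r > (0:ℝ), ∃ u : ℂ, (u = 1 ∨ u = -1 ∨ u = Complex.I ∨ u = -Complex.I) ∧
            G.carrier ∩ Metric.ball (G.pt 2) r =
              {z | z ∈ Metric.ball (G.pt 2) r ∧ 0 < ((z - G.pt 2) * (starRingEnd ℂ) u).re}) ∧
          (∀ z ∈ G.carrier, z ∉ R.carrier →
            infDist z (R.arc 1) ≤ t ∨ infDist z (R.arc 3) ≤ t) ∧
          (∀ z ∈ G.carrier, z ∈ R.carrier →
            d ≤ infDist z (R.arc 0) ∧ d ≤ infDist z (R.arc 2) ∧ ∀ j : Fin 4, d ≤ dist z (R.pt j)) ∧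
          ∃ s > (0:ℝ),
            (∀ z, infDist z (G.arc 3) ≤ s → s ≤ infDist z R.carrier ∧ infDist z (R.arc 3) ≤ t) ∧
            (∀ z, infDist z (G.arc 1) ≤ s → s ≤ infDist z R.carrier ∧ infDist z (R.arc 1) ≤ t)) := by
  sorry

/-- Stub 4 (M): admissible discretisation families at flat axis-parallel junctions.
See `FlatJunctionFamily`. -/
theorem stub_flatJunctionFamily :
    ∀ G : ConformalRectangle,
      (∃ r > (0:ℝ), ∃ u : ℂ, (u = 1 ∨ u = -1 ∨ u = Complex.I ∨ u = -Complex.I) ∧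
        G.carrier ∩ Metric.ball (G.pt 0) r =
          {z | z ∈ Metric.ball (G.pt 0) r ∧ 0 < ((z - G.pt 0) * (starRingEnd ℂ) u).re}) →
      (∃ r > (0:ℝ), ∃ u : ℂ, (u = 1 ∨ u = -1 ∨ u = Complex.I ∨ u = -Complex.I) ∧
        G.carrier ∩ Metric.ball (G.pt 2) r =
          {z | z ∈ Metric.ball (G.pt 2) r ∧ 0 < ((z - G.pt 2) * (starRingEnd ℂ) u).re}) →
      ∃ Λ : ℝ → DiscreteDobrushin, ZdDiscretisationFamily (G.chord 0 2 (by decide)) Λ := by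
  sorry

/-- Stub 5 (M; SHARED verbatim with `ConformalCollarSsBridge.stub_proximityLiminf`): one-sided
eventual bounds for the open proximity events from SLE₆ convergence (portmanteau +
`hitsBefore_eq_iUnion_iInter` + LSW hitting law). See `ProximityBounds`. -/
theorem stub_proximityBounds :
    ∀ (G : ConformalRectangle) (X : ℝ → BondConfig (Site 2) → CurveClass ℂ),
      ConvergesInLawToSLE 6 (G.chord 0 2 (by decide)) (Ωδ := fun _ => BondConfig (Site 2)) X
          (fun _ => bondPercolation (zdGraph 2) half) →
      ∀ (ψ : ConformalEquiv upperHalfPlaneSet G.carrier) (y : Fin 4 → ℝ), G.IsUniformizing ψ y →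
        ∀ θ > (0:ℝ), ∃ b > (0:ℝ), ∀ a > (0:ℝ), ∀ᶠ δ in 𝓝[>] (0:ℝ),
          cardyFunction (crossRatio y) - θ ≤
              (bondPercolation (zdGraph 2) half).real
                ((X δ) ⁻¹' (CurveClass.mk '' CurveClass.hitsBeforeApprox (G.arc 2) (G.arc 1) a b)) ∧
          1 - cardyFunction (crossRatio y) - θ ≤
              (bondPercolation (zdGraph 2) half).real
                ((X δ) ⁻¹' (CurveClass.mk '' CurveClass.hitsBeforeApprox (G.arc 1) (G.arc 2) a b)) := by
  sorry

/-- Stub 6 (M): proximity event of the oriented interface ⇒ `ω`-open escort chain.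
See `OpenEscortChain`. -/
theorem stub_openEscortChain :
    ∀ (G : ConformalRectangle) (Λ : ℝ → DiscreteDobrushin),
      ZdDiscretisationFamily (G.chord 0 2 (by decide)) Λ → ∀ ε a b : ℝ, 0 < ε → 0 < a → 0 < b →
      ∀ᶠ δ in 𝓝[>] (0:ℝ), ∀ ω : BondConfig (Site 2),
        CurveClass.mk
            (if dist (medialExplorationCurve (Λ δ) ω 0) ((G.chord 0 2 (by decide)).pt 0) ≤
                dist (medialExplorationCurve (Λ δ) ω 0) ((G.chord 0 2 (by decide)).pt 1) then
              (⟨medialExplorationCurve (Λ δ) ω⟩ : Curve ℂ)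
            else ⟨(medialExplorationCurve (Λ δ) ω).comp
              ⟨unitInterval.symm, unitInterval.continuous_symm⟩⟩) ∈
            CurveClass.mk '' CurveClass.hitsBeforeApprox (G.arc 2) (G.arc 1) a b →
          ∃ (N : ℕ) (v : ℕ → Site 2),
            (∀ i < N, (zdGraph 2).Adj (v i) (v (i + 1)) ∧ s(v i, v (i + 1)) ∈ ω) ∧
            (∀ i ≤ N, v i ∈ meshDomain G.carrier δ) ∧
            infDist (meshPoint δ (v 0)) (G.arc 0) ≤ ε ∧
            infDist (meshPoint δ (v N)) (G.arc 2) ≤ a + ε ∧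
            ∀ i ≤ N, b - ε ≤ infDist (meshPoint δ (v i)) (G.arc 1) := by
  sorry

/-- Stub 7 (M): complementary proximity event ⇒ closed dual escort chain. See `DualEscortChain`. -/
theorem stub_dualEscortChain :
    ∀ (G : ConformalRectangle) (Λ : ℝ → DiscreteDobrushin),
      ZdDiscretisationFamily (G.chord 0 2 (by decide)) Λ → ∀ ε a b : ℝ, 0 < ε → 0 < a → 0 < b →
      ∀ᶠ δ in 𝓝[>] (0:ℝ), ∀ ω : BondConfig (Site 2),
        CurveClass.mk
            (if dist (medialExplorationCurve (Λ δ) ω 0) ((G.chord 0 2 (by decide)).pt 0) ≤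
                dist (medialExplorationCurve (Λ δ) ω 0) ((G.chord 0 2 (by decide)).pt 1) then
              (⟨medialExplorationCurve (Λ δ) ω⟩ : Curve ℂ)
            else ⟨(medialExplorationCurve (Λ δ) ω).comp
              ⟨unitInterval.symm, unitInterval.continuous_symm⟩⟩) ∈
            CurveClass.mk '' CurveClass.hitsBeforeApprox (G.arc 1) (G.arc 2) a b →
          ∃ (N : ℕ) (f : ℕ → Site 2),
            (∀ i < N, (zdGraph 2).Adj (f i) (f (i + 1)) ∧ s(f i, f (i + 1)) ∈ dualConfig ω) ∧
            (∀ i ≤ N, f i ∈ meshDomain G.carrier δ) ∧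
            infDist (meshPoint δ (f 0)) (G.arc 3) ≤ ε ∧
            infDist (meshPoint δ (f N)) (G.arc 1) ≤ a + ε ∧
            ∀ i ≤ N, b - ε ≤ infDist (meshPoint δ (f i)) (G.arc 2) := by
  sorry

/-! ## Bookkeeping lemmas for the composition (proved) -/

/-- Two-sided eventual bounds give the limit (the `ε`-form of `liminf ≥ F ≥ limsup`). -/
theorem tendsto_of_eventually_le_le {p : ℝ → ℝ} {F : ℝ}
    (hlo : ∀ θ > 0, ∀ᶠ δ in 𝓝[>] (0:ℝ), F - θ ≤ p δ)
    (hhi : ∀ θ > 0, ∀ᶠ δ in 𝓝[>] (0:ℝ), p δ ≤ F + θ) :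
    Tendsto p (𝓝[>] (0:ℝ)) (𝓝 F) := by
  rw [Metric.tendsto_nhds]
  intro ε hε
  filter_upwards [hlo (ε / 2) (half_pos hε), hhi (ε / 2) (half_pos hε)] with δ h1 h2
  rw [Real.dist_eq, abs_lt]
  constructor <;> linarith

/-- Eventually along `𝓝[>] 0` the mesh is positive. -/
theorem eventually_pos : ∀ᶠ δ in 𝓝[>] (0:ℝ), 0 < δ := eventually_mem_nhdsWithin

/-- Eventually along `𝓝[>] 0` the mesh is below any positive threshold. -/
theorem eventually_lt {c : ℝ} (hc : 0 < c) : ∀ᶠ δ in 𝓝[>] (0:ℝ), δ < c :=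
  nhdsWithin_le_nhds (Iio_mem_nhds hc)

/-- Sites of the discrete domain have their mesh points in the domain. -/
theorem meshPoint_mem_of_mem_meshDomain {Ω : Set ℂ} {δ : ℝ} {x : Site 2}
    (hx : x ∈ meshDomain Ω δ) : meshPoint δ x ∈ Ω :=
  mem_meshVertices_iff.1 (meshDomain_subset_meshVertices Ω δ hx)

/-! ## The two half-assemblies and the composition (kernel-checked, no `sorry` of their own) -/

/-- **Lower bound** `F(η) - θ ≤ P[C_δ(R)]` eventually, from stubs 1, 3 (lower), 4, 5 (lower), 6 and
the antecedent `H`. -/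
theorem eventually_le_crossingProb (h1 : OvershootInclusion) (h3 : LowerLuneDomain)
    (h4 : FlatJunctionFamily) (h5 : ProximityBounds) (h6 : OpenEscortChain) (H : SLE6Families)
    (R : ConformalRectangle) (φ : ConformalEquiv upperHalfPlaneSet R.carrier) (x : Fin 4 → ℝ)
    (hφx : R.IsUniformizing φ x) :
    ∀ θ > (0:ℝ), ∀ᶠ δ in 𝓝[>] (0:ℝ), cardyFunction (crossRatio x) - θ ≤ bondDomainCrossingProb R δ := by
  intro θ hθ
  have hθ2 : 0 < θ / 2 := half_pos hθ
  obtain ⟨δ₁, hδ₁, t₀, ht₀, hincl⟩ := h1 R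
  obtain ⟨d, hd, hG⟩ := h3 R φ x hφx (θ / 2) hθ2
  obtain ⟨G, ψ, y, hψy, hF, hfl0, hfl2, hthin, hfar, s, hs, harc0, harc2⟩ := hG t₀ ht₀
  obtain ⟨Λ, hΛ⟩ := h4 G hfl0 hfl2
  have hconv := H (G.chord 0 2 (by decide)) Λ hΛ.Ω_eq hΛ.δ_eq hΛ.tendsto_arcA hΛ.tendsto_arcB
    hΛ.tendsto_zdABEdges hΛ.eventually_isZdAdmissible
  obtain ⟨b, hb, hbound⟩ := h5 G _ hconv ψ y hψy (θ / 2) hθ2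
  have hs2 : 0 < s / 2 := half_pos hs
  have hchain := h6 G Λ hΛ (s / 2) (s / 2) b hs2 hs2 hb
  filter_upwards [hbound (s / 2) hs2, hchain, eventually_pos, eventually_lt hδ₁, eventually_lt hd]
    with δ hPδ2 hchδ hδpos hδlt hδd
  obtain ⟨hPδ, -⟩ := hPδ2
  -- the proximity event of the comparison domain is INCLUDED in the crossing event of `R`
  have hsub : (fun ω => interfaceMap (G.chord 0 2 (by decide)) (Λ δ) ω) ⁻¹'
      (CurveClass.mk '' CurveClass.hitsBeforeApprox (G.arc 2) (G.arc 1) (s / 2) b) ⊆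
      discreteCrossing R.carrier δ (R.arc 0) (R.arc 2) := by
    intro ω hω
    obtain ⟨N, v, hopen, hdom, hv0, hvN, hfar1⟩ := hchδ ω hω
    refine hincl δ t₀ hδpos hδlt ht₀.le le_rfl ω N v hopen ?_ ?_ ?_ ?_ ?_ ?_
    · intro i hi hout
      exact hthin _ (meshPoint_mem_of_mem_meshDomain (hdom i hi)) hout
    · intro i hi hin
      obtain ⟨hA, hB⟩ := hfar _ (meshPoint_mem_of_mem_meshDomain (hdom i hi)) hin
      exact ⟨hδd.trans_le hA, hδd.trans_le hB⟩
    · exact (harc0 _ (hv0.trans (half_le_self hs.le))).1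
    · exact (harc0 _ (hv0.trans (half_le_self hs.le))).2
    · exact (harc2 _ (hvN.trans_eq (add_halves s))).1
    · exact (harc2 _ (hvN.trans_eq (add_halves s))).2
  have hPδ' : cardyFunction (crossRatio y) - θ / 2 ≤
      (bondPercolation (zdGraph 2) half).real
        ((fun ω => interfaceMap (G.chord 0 2 (by decide)) (Λ δ) ω) ⁻¹'
          (CurveClass.mk '' CurveClass.hitsBeforeApprox (G.arc 2) (G.arc 1) (s / 2) b)) := hPδ
  have hF' := abs_le.1 hF
  rw [bondDomainCrossingProb_eq_measureReal]
  calc cardyFunction (crossRatio x) - θ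
      ≤ cardyFunction (crossRatio y) - θ / 2 := by linarith [hF'.1, hF'.2]
    _ ≤ _ := hPδ'
    _ ≤ (bondPercolation (zdGraph 2) half).real (discreteCrossing R.carrier δ (R.arc 0) (R.arc 2)) :=
        measureReal_mono hsub

/-- **Upper bound** `P[C_δ(R)] ≤ F(η) + θ` eventually, from stubs 2, 3 (upper), 4, 5 (upper), 7 and
the antecedent `H`. -/
theorem crossingProb_eventually_le (h2 : DualOvershootExclusion) (h3 : UpperLuneDomain)
    (h4 : FlatJunctionFamily) (h5 : ProximityBounds) (h7 : DualEscortChain) (H : SLE6Families)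
    (R : ConformalRectangle) (φ : ConformalEquiv upperHalfPlaneSet R.carrier) (x : Fin 4 → ℝ)
    (hφx : R.IsUniformizing φ x) :
    ∀ θ > (0:ℝ), ∀ᶠ δ in 𝓝[>] (0:ℝ), bondDomainCrossingProb R δ ≤ cardyFunction (crossRatio x) + θ := by
  intro θ hθ
  have hθ2 : 0 < θ / 2 := half_pos hθ
  obtain ⟨d, hd, hG⟩ := h3 R φ x hφx (θ / 2) hθ2
  obtain ⟨δ₁, hδ₁, t₀, ht₀, hexcl⟩ := h2 R d hd
  obtain ⟨G, ψ, y, hψy, hF, hfl0, hfl2, hthin, hfar, s, hs, harc3, harc1⟩ := hG t₀ ht₀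
  obtain ⟨Λ, hΛ⟩ := h4 G hfl0 hfl2
  have hconv := H (G.chord 0 2 (by decide)) Λ hΛ.Ω_eq hΛ.δ_eq hΛ.tendsto_arcA hΛ.tendsto_arcB
    hΛ.tendsto_zdABEdges hΛ.eventually_isZdAdmissible
  obtain ⟨b, hb, hbound⟩ := h5 G _ hconv ψ y hψy (θ / 2) hθ2
  have hs2 : 0 < s / 2 := half_pos hs
  have hchain := h7 G Λ hΛ (s / 2) (s / 2) b hs2 hs2 hb
  have hd8 : 0 < d / 8 := by positivity
  have hs8 : 0 < s / 8 := by positivity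
  filter_upwards [hbound (s / 2) hs2, hchain, eventually_pos, eventually_lt hδ₁, eventually_lt hd8,
    eventually_lt hs8] with δ hPδ2 hchδ hδpos hδlt hδd hδs
  obtain ⟨-, hPδ⟩ := hPδ2
  -- the complementary proximity event of the comparison domain EXCLUDES the crossing event
  have hdisj : Disjoint
      ((fun ω => interfaceMap (G.chord 0 2 (by decide)) (Λ δ) ω) ⁻¹'
        (CurveClass.mk '' CurveClass.hitsBeforeApprox (G.arc 1) (G.arc 2) (s / 2) b))
      (discreteCrossing R.carrier δ (R.arc 0) (R.arc 2)) := by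
    rw [Set.disjoint_left]
    intro ω hω hC
    obtain ⟨N, f, hdual, hdom, hf0, hfN, hfar2⟩ := hchδ ω hω
    refine hexcl δ t₀ hδpos hδlt ht₀.le le_rfl ω N f hdual ?_ ?_ ?_ ?_ ?_ ?_ hC
    · intro i hi hout
      exact hthin _ (meshPoint_mem_of_mem_meshDomain (hdom i hi)) hout
    · intro i hi hin
      obtain ⟨hA, hB, hpt⟩ := hfar _ (meshPoint_mem_of_mem_meshDomain (hdom i hi)) hin
      exact ⟨by linarith, by linarith, hpt⟩
    · have := (harc3 _ (hf0.trans (half_le_self hs.le))).1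
      linarith
    · exact (harc3 _ (hf0.trans (half_le_self hs.le))).2
    · have := (harc1 _ (hfN.trans_eq (add_halves s))).1
      linarith
    · exact (harc1 _ (hfN.trans_eq (add_halves s))).2
  have hPδ' : 1 - cardyFunction (crossRatio y) - θ / 2 ≤
      (bondPercolation (zdGraph 2) half).real
        ((fun ω => interfaceMap (G.chord 0 2 (by decide)) (Λ δ) ω) ⁻¹'
          (CurveClass.mk '' CurveClass.hitsBeforeApprox (G.arc 1) (G.arc 2) (s / 2) b)) := hPδ
  have hsum : (bondPercolation (zdGraph 2) half).real
        ((fun ω => interfaceMap (G.chord 0 2 (by decide)) (Λ δ) ω) ⁻¹'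
          (CurveClass.mk '' CurveClass.hitsBeforeApprox (G.arc 1) (G.arc 2) (s / 2) b)) +
      (bondPercolation (zdGraph 2) half).real (discreteCrossing R.carrier δ (R.arc 0) (R.arc 2))
        ≤ 1 := by
    rw [← measureReal_union hdisj (measurableSet_discreteCrossing _ _ _ _)]
    exact measureReal_le_one
  have hF' := abs_le.1 hF
  rw [bondDomainCrossingProb_eq_measureReal]
  linarith [hF'.1, hF'.2]

/-- **Cardy's formula from the seven statements** (statements as hypotheses; conclusion = the crux
UNFOLDED, `SLE6Families → CardyFormulaZ2`, so that the audit sees exactly one theorem concluding the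
crux by name, `SLESixFamiliesGiveCardy_of` below): Cardy's formula for `R` is the limit squeezed
between the two eventual bounds. -/
theorem cardy_of_statements (h1 : OvershootInclusion) (h2 : DualOvershootExclusion)
    (h3 : LowerLuneDomain ∧ UpperLuneDomain) (h4 : FlatJunctionFamily) (h5 : ProximityBounds)
    (h6 : OpenEscortChain) (h7 : DualEscortChain) : SLE6Families → _root_.CardyFormulaZ2 := by
  intro H R φ x hφx
  exact tendsto_of_eventually_le_le
    (eventually_le_crossingProb h1 h3.1 h4 h5 h6 H R φ x hφx)
    (crossingProb_eventually_le h2 h3.2 h4 h5 h7 H R φ x hφx)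

/-- **`SLESixFamiliesGiveCardy` from the seven registered stubs** — the kernel-checked composition:
the route decl BY NAME (`crux_iff` is `Iff.rfl`), no hypothesis, no `sorry` of its own (the only
`sorry`s of the file are the seven `stub_*`). -/
theorem SLESixFamiliesGiveCardy_of : SLESixFamiliesGiveCardy :=
  crux_iff.2 (cardy_of_statements stub_overshootInclusion stub_dualOvershootExclusion stub_luneDomains
    stub_flatJunctionFamily stub_proximityBounds stub_openEscortChain stub_dualEscortChain)

end Summit.CriticalPhenomena.CardyFormulaZ2.Cruxes.SLESixFamiliesGiveCardy.OvershootLuneSandwich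

end
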